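import Mathlib

/-!
# NE7EJFlatSecular — row NE7 (node U5), candidate route HOM, variant H1L-EJ, item EJ-1b′ (T1)–(T3′): LENS 1's THEOREM (hh) IN KERNEL —
# the FLAT SHARP SECULAR INEQUALITY `S_φ(p) ≤ 1` for `φ = ⅛x²(4 − x)`, with the degree-10 identity `Π_n G(u_n)·(1 − S_φ) = A·B·Q̃(A,B)`
# and EQUALITY EXACTLY ON THE AXES

Lineage `b2b-balaban-t4-ne7-p2` (CRUX PROVER NE7 #2 = C-HOM°'s kernel hand), generation 81; file 117.  Mathlib-only imports.

SOURCE (lens 1 = `t4-ne7-idea-1`, toy P-EJ-9 ∕ P-EJ-10; d = 2, L = 2, one RG step, FLAT abelian model; her words «TOY-MODEL LADDER RUNG …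
never the NE7 estimate»): gen 67 `t4/ideate/NE7/lens1-g67/DEFECT-VS-HESSIAN-NOTE.md` 9e7cf2b6f8adbc99 §1 (A2)–(A3) reduce the flat master
inequality «EF^flat ≥ φ(Hess_f^flat) on phys, every torus» (EF := Hess_f − ¼Q†Hess_cQ the one-step defect form of Bałaban's (42)) to ONE
inequality between trigonometric polynomials: with `y_μ := sin²(p_μ∕2)`, `x_μ := 1 − y_μ`, alias labels `n ∈ {0,1}²`,
`u_n := Σ_μ (y_μ if n_μ = 0 else x_μ)` (`= ω_n∕4`), `w_n := Π_μ (x_μ² if n_μ = 0 else y_μ²)` (`= |t_n|²`) and `g(4u) = G(u) := (1 − u)² + u²`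
(for `φ = ⅛x²(4 − x)`, `g := 1 − φ(ω)∕ω`), the SECULAR CRITERION reads `S_φ(p) := Σ_n w_n ∕ G(u_n) ≤ 1`.  Gen 68
`t4/ideate/NE7/lens1-g68/FIBRE-NOTE.md` c9daf19675253d99 §1 THEOREM (hh) [her tag: paper + exact rational arithmetic]: for all
`(y₁, y₂) ∈ [0,1]²`, `Π_n G(u_n)·(1 − S_φ) = A·B·Q̃(A,B)` with `A := x₁y₁`, `B := x₂y₂ ∈ [0,¼]` and
`Q̃(A,B) = 40(A+B) + 32(A²+B²) + 32(A³+B³) − 192AB − 32AB(A+B) = 16(A+B) + 32(A²+B²) + 32(A+B)(A−B)² + 24[A(1−4B) + B(1−4A)] ≥ 0`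
on `[0,¼]²`; hence `S_φ ≤ 1` everywhere with equality iff `A·B = 0` (an axis).  THIS FILE is that theorem in kernel:
* §1 `G`, `G_eq`, `G_pos`, `half_le_G`, `G_one_sub` (the axis identity `g(4y) = g(4x)`), `G_le_of` (`G ≤ 5` on `[0,2]`).
* §2 the alias data `uu ∕ ww` on `Bool × Bool`, their ranges, `sum_ww_le_one`-type bookkeeping (`Σ_n w_n ≤ 1`, `= 1` iff a corner).
* §3 `Qt`, **`Qt_eq_pos_form`** (the two displayed forms agree, `ring`), **`Qt_nonneg`** on `[0,¼]²`, `Qt_pos` off the origin.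
* §4 **`secular_identity`**: `Π_n G(u_n) − Σ_n w_n·Π_{n′≠n} G(u_{n′}) = A·B·Q̃(A,B)` — the degree-10 identity, by `ring`.
* §5 **`secular_le_one`**: `Σ_n w_n ∕ G(u_n) ≤ 1` on `[0,1]²`; **`secular_eq_one_iff`**: `= 1 ↔ y₁ ∈ {0,1} ∨ y₂ ∈ {0,1}`;
  `secular_lt_one` off the axes; `one_sub_secular_eq` (the slack in closed form `A·B·Q̃ ∕ ΠG`).
* §6 the trigonometric dictionary: `y = sin²(p∕2) ∈ [0,1]`, `x·y = ¼sin²p`, `y ∈ {0,1} ↔ sin p = 0`, and **`secular_le_one_trig`** ∕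
  **`secular_eq_one_trig_iff`** (equality iff `sin p₁ = 0 ∨ sin p₂ = 0`, i.e. `p` on an axis alias block mod π).
The operator-level reading (rank-one `|t⟩⟨t| ≤ diag g(ω_n)` per alias block, and the transport to `EF^flat ≥ φ(Hess^flat)`) is files 118–119.

HONEST FRAMING: [folklore] real algebra (one polynomial identity, one positivity certificate, bookkeeping); the OBJECTS (the d = 2, L = 2 flat
toy, (42)'s tent multiset, the secular reduction) are lens 1's and stay hers — this file certifies her THEOREM (hh) exactly as displayed, nothing
of Bałaban's is instantiated, no d = 4 statement, no curved background, no (MI₂) at ε > 0; NOT a letter move (PRICING-NE7 v50: EJ-1b′ M tag (I),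
H1L ∕ H1L-EJ XL−, zero letter expected from toy rungs); T-50-10 honoured (no per-cell non-abelian statement).  NE7 NOT PRINTED ∕ NOT PROVED;
spine 0∕9; FIXED FINITE T⁴, rung (B)+1; NOT infinite volume, NOT mass gap, NOT Clay.  HONEST DEPENDENCY: continuum YM on T⁴ ⇐ BetaPertH ∧ nine
spine estimates (0/9 proved); BetaPertH ⇐ (D1) ∧ (D4) ∧ CAP+tail; G-an2-4 gates asym, D1 and NE2/3/4.
-/

noncomputable section

open Finset Real

namespace Summit.QuantumFields.BalabanUV.T4Continuum.NE7EJFlatSecular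

/-! ### §1 The denominator `G(u) = (1 − u)² + u² = g(4u)` -/

/-- `G u := (1 − u)² + u²` — lens 1's `g(ω) = 1 − φ(ω)∕ω` at `ω = 4u` for the flat-sharp cubic `φ = ⅛x²(4 − x)`. [folklore] -/
def G (u : ℝ) : ℝ := (1 - u) ^ 2 + u ^ 2

/-- completed square: `G u = 2(u − ½)² + ½`. [folklore] -/
theorem G_eq (u : ℝ) : G u = 2 * (u - 1 / 2) ^ 2 + 1 / 2 := by unfold G; ring

/-- `G` agrees with `1 − ψ(4u)`, `ψ(x) = φ(x)∕x = ½x − ⅛x²` (the form used by files 118–119). [folklore] -/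
theorem G_eq_one_sub_psi (u : ℝ) : G u = 1 - ((1 / 2) * (4 * u) - (1 / 8) * (4 * u) ^ 2) := by unfold G; ring

/-- `½ ≤ G u`. [folklore] -/
theorem half_le_G (u : ℝ) : 1 / 2 ≤ G u := by rw [G_eq]; nlinarith [sq_nonneg (u - 1 / 2)]

/-- `0 < G u`. [folklore] -/
theorem G_pos (u : ℝ) : 0 < G u := lt_of_lt_of_le (by norm_num) (half_le_G u)

/-- `G u ≠ 0`. [folklore] -/
theorem G_ne_zero (u : ℝ) : G u ≠ 0 := (G_pos u).ne'

/-- THE AXIS IDENTITY `G(1 − u) = G(u)` (lens 1 gen 67 (A4): `g(4y) = (1 − y)² + y² = g(4x)`). [folklore] -/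
theorem G_one_sub (u : ℝ) : G (1 - u) = G u := by unfold G; ring

/-- values: `G 0 = 1`, `G 1 = 1`, `G 2 = 5`, `G (1∕2) = 1∕2`. [folklore] -/
theorem G_values : G 0 = 1 ∧ G 1 = 1 ∧ G 2 = 5 ∧ G (1 / 2) = 1 / 2 := by unfold G; norm_num

/-- on `[0,2]` (the range of `u_n`): `G u ≤ 5`. [folklore] -/
theorem G_le_five {u : ℝ} (h0 : 0 ≤ u) (h2 : u ≤ 2) : G u ≤ 5 := by rw [G_eq]; nlinarith

/-! ### §2 The alias data `u_n`, `w_n` on `n ∈ {0,1}²` (coded as `Bool × Bool`, `false` = 0) -/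

/-- alias labels `n ∈ {0,1}²` of the L = 2 blocking in d = 2; `false` codes `n_μ = 0` (the un-shifted momentum component). [folklore] -/
abbrev Alias := Bool × Bool

/-- `u_n(y₁,y₂) := Σ_μ (y_μ if n_μ = 0 else 1 − y_μ)` — a quarter of the plaquette-Laplacian symbol `ω_n = 4Σ_μ sin²((p_μ + πn_μ)∕2)` at
`y_μ = sin²(p_μ∕2)`. [folklore] -/
def uu (y₁ y₂ : ℝ) (n : Alias) : ℝ := (if n.1 then 1 - y₁ else y₁) + (if n.2 then 1 - y₂ else y₂)

/-- `w_n(y₁,y₂) := Π_μ ((1 − y_μ)² if n_μ = 0 else y_μ²)` — the squared modulus `|t_n|² = Π_μ (cos⁴ ∕ sin⁴)(p_μ∕2)` of the tent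
average's alias amplitude. [folklore] -/
def ww (y₁ y₂ : ℝ) (n : Alias) : ℝ := (if n.1 then y₁ ^ 2 else (1 - y₁) ^ 2) * (if n.2 then y₂ ^ 2 else (1 - y₂) ^ 2)

/-- the four values of `u`. [folklore] -/
theorem uu_values (y₁ y₂ : ℝ) : uu y₁ y₂ (false, false) = y₁ + y₂ ∧ uu y₁ y₂ (false, true) = y₁ + (1 - y₂) ∧
    uu y₁ y₂ (true, false) = (1 - y₁) + y₂ ∧ uu y₁ y₂ (true, true) = (1 - y₁) + (1 - y₂) := by simp [uu]

/-- the four values of `w`. [folklore] -/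
theorem ww_values (y₁ y₂ : ℝ) : ww y₁ y₂ (false, false) = (1 - y₁) ^ 2 * (1 - y₂) ^ 2 ∧ ww y₁ y₂ (false, true) = (1 - y₁) ^ 2 * y₂ ^ 2 ∧
    ww y₁ y₂ (true, false) = y₁ ^ 2 * (1 - y₂) ^ 2 ∧ ww y₁ y₂ (true, true) = y₁ ^ 2 * y₂ ^ 2 := by simp [ww]

/-- `0 ≤ w_n`. [folklore] -/
theorem ww_nonneg (y₁ y₂ : ℝ) (n : Alias) : 0 ≤ ww y₁ y₂ n := by
  unfold ww; split_ifs <;> positivity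

/-- on `[0,1]²`: `0 ≤ u_n ≤ 2`. [folklore] -/
theorem uu_mem {y₁ y₂ : ℝ} (h₁ : y₁ ∈ Set.Icc (0:ℝ) 1) (h₂ : y₂ ∈ Set.Icc (0:ℝ) 1) (n : Alias) : 0 ≤ uu y₁ y₂ n ∧ uu y₁ y₂ n ≤ 2 := by
  obtain ⟨a0, a1⟩ := h₁; obtain ⟨b0, b1⟩ := h₂
  unfold uu; split_ifs <;> constructor <;> linarith

/-- a sum over the four alias labels, written out. [folklore] -/
theorem sum_alias (f : Alias → ℝ) : ∑ n, f n = f (false, false) + f (false, true) + f (true, false) + f (true, true) := by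
  rw [Fintype.sum_prod_type]; simp; ring

/-- a product over the four alias labels, written out. [folklore] -/
theorem prod_alias (f : Alias → ℝ) : ∏ n, f n = f (false, false) * f (false, true) * f (true, false) * f (true, true) := by
  rw [Fintype.prod_prod_type]; simp; ring

/-- `Σ_n w_n = ((1−y₁)² + y₁²)((1−y₂)² + y₂²) = G(y₁)G(y₂)` (the alias amplitudes' total weight). [folklore] -/
theorem sum_ww_eq (y₁ y₂ : ℝ) : ∑ n, ww y₁ y₂ n = G y₁ * G y₂ := by
  rw [sum_alias]; simp only [ww, G]; simp; ring

/-- hence `Σ_n w_n ≤ 1` on `[0,1]²` (since `G ≤ 1` there). [folklore] -/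
theorem sum_ww_le_one {y₁ y₂ : ℝ} (h₁ : y₁ ∈ Set.Icc (0:ℝ) 1) (h₂ : y₂ ∈ Set.Icc (0:ℝ) 1) : ∑ n, ww y₁ y₂ n ≤ 1 := by
  rw [sum_ww_eq]
  obtain ⟨a0, a1⟩ := h₁; obtain ⟨b0, b1⟩ := h₂
  have hG1 : G y₁ ≤ 1 := by unfold G; nlinarith
  have hG2 : G y₂ ≤ 1 := by unfold G; nlinarith
  calc G y₁ * G y₂ ≤ 1 * 1 := mul_le_mul hG1 hG2 (G_pos y₂).le zero_le_one
    _ = 1 := by ring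

/-! ### §3 The quotient polynomial `Q̃` and its positivity certificate on `[0,¼]²` -/

/-- lens 1's `Q̃(A,B) = 40(A+B) + 32(A²+B²) + 32(A³+B³) − 192AB − 32AB(A+B)`. [folklore] -/
def Qt (A B : ℝ) : ℝ := 40 * (A + B) + 32 * (A ^ 2 + B ^ 2) + 32 * (A ^ 3 + B ^ 3) - 192 * A * B - 32 * A * B * (A + B)

/-- **the two displayed forms agree**: `Q̃ = 16(A+B) + 32(A²+B²) + 32(A+B)(A−B)² + 24[A(1−4B) + B(1−4A)]` (lens 1: `Qt − Qt_pos == 0: True`).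
[folklore] -/
theorem Qt_eq_pos_form (A B : ℝ) :
    Qt A B = 16 * (A + B) + 32 * (A ^ 2 + B ^ 2) + 32 * (A + B) * (A - B) ^ 2 + 24 * (A * (1 - 4 * B) + B * (1 - 4 * A)) := by
  unfold Qt; ring

/-- `Q̃` is symmetric. [folklore] -/
theorem Qt_comm (A B : ℝ) : Qt A B = Qt B A := by unfold Qt; ring

/-- **positivity certificate**: `0 ≤ Q̃(A,B)` for `A, B ∈ [0,¼]` — every term of the second form is `≥ 0` there (`1 − 4B ≥ 0`). [folklore] -/
theorem Qt_nonneg {A B : ℝ} (hA0 : 0 ≤ A) (hA : A ≤ 1 / 4) (hB0 : 0 ≤ B) (hB : B ≤ 1 / 4) : 0 ≤ Qt A B := by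
  rw [Qt_eq_pos_form]
  have h1 : 0 ≤ 1 - 4 * B := by linarith
  have h2 : 0 ≤ 1 - 4 * A := by linarith
  positivity

/-- the linear part alone bounds `Q̃` below: `16(A+B) ≤ Q̃(A,B)` on `[0,¼]²`. [folklore] -/
theorem sixteen_mul_le_Qt {A B : ℝ} (hA0 : 0 ≤ A) (hA : A ≤ 1 / 4) (hB0 : 0 ≤ B) (hB : B ≤ 1 / 4) : 16 * (A + B) ≤ Qt A B := by
  rw [Qt_eq_pos_form]
  have h1 : 0 ≤ 1 - 4 * B := by linarith
  have h2 : 0 ≤ 1 - 4 * A := by linarith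
  have : 0 ≤ 32 * (A ^ 2 + B ^ 2) + 32 * (A + B) * (A - B) ^ 2 + 24 * (A * (1 - 4 * B) + B * (1 - 4 * A)) := by positivity
  linarith

/-- hence `0 < Q̃(A,B)` on `[0,¼]²` off the origin. [folklore] -/
theorem Qt_pos {A B : ℝ} (hA0 : 0 ≤ A) (hA : A ≤ 1 / 4) (hB0 : 0 ≤ B) (hB : B ≤ 1 / 4) (h : 0 < A + B) : 0 < Qt A B :=
  lt_of_lt_of_le (by linarith) (sixteen_mul_le_Qt hA0 hA hB0 hB)

/-- `Q̃(0,0) = 0` (the corner where the Bernstein minimum 0 is attained). [folklore] -/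
theorem Qt_zero_zero : Qt 0 0 = 0 := by unfold Qt; norm_num

/-! ### §4 The degree-10 secular identity -/

/-- the SECULAR POLYNOMIAL `P(y₁,y₂) := Π_n G(u_n) − Σ_n w_n·Π_{n′≠n} G(u_{n′})` (lens 1 gen 68 §1: «an integer polynomial of degree 10,
38 monomials»). [folklore] -/
def secularP (y₁ y₂ : ℝ) : ℝ := ∏ n, G (uu y₁ y₂ n) - ∑ n, ww y₁ y₂ n * ∏ m ∈ univ.erase n, G (uu y₁ y₂ m)

/-- the erased products over the four labels, written out. [folklore] -/
theorem prod_erase_alias (f : Alias → ℝ) :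
    (∏ m ∈ univ.erase (false, false), f m = f (false, true) * f (true, false) * f (true, true)) ∧
    (∏ m ∈ univ.erase (false, true), f m = f (false, false) * f (true, false) * f (true, true)) ∧
    (∏ m ∈ univ.erase (true, false), f m = f (false, false) * f (false, true) * f (true, true)) ∧
    (∏ m ∈ univ.erase (true, true), f m = f (false, false) * f (false, true) * f (true, false)) := by
  have h1 : (univ : Finset Alias).erase (false, false) = {(false, true), (true, false), (true, true)} := by decide
  have h2 : (univ : Finset Alias).erase (false, true) = {(false, false), (true, false), (true, true)} := by decide
  have h3 : (univ : Finset Alias).erase (true, false) = {(false, false), (false, true), (true, true)} := by decide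
  have h4 : (univ : Finset Alias).erase (true, true) = {(false, false), (false, true), (true, false)} := by decide
  refine ⟨?_, ?_, ?_, ?_⟩
  · rw [h1, prod_insert (by decide), prod_insert (by decide), prod_singleton]; ring
  · rw [h2, prod_insert (by decide), prod_insert (by decide), prod_singleton]; ring
  · rw [h3, prod_insert (by decide), prod_insert (by decide), prod_singleton]; ring
  · rw [h4, prod_insert (by decide), prod_insert (by decide), prod_singleton]; ring

/-- `P` written out in the four labels. [folklore] -/
theorem secularP_eq (y₁ y₂ : ℝ) : secularP y₁ y₂ =
    G (y₁ + y₂) * G (y₁ + (1 - y₂)) * G ((1 - y₁) + y₂) * G ((1 - y₁) + (1 - y₂))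
    - ((1 - y₁) ^ 2 * (1 - y₂) ^ 2 * (G (y₁ + (1 - y₂)) * G ((1 - y₁) + y₂) * G ((1 - y₁) + (1 - y₂)))
      + (1 - y₁) ^ 2 * y₂ ^ 2 * (G (y₁ + y₂) * G ((1 - y₁) + y₂) * G ((1 - y₁) + (1 - y₂)))
      + y₁ ^ 2 * (1 - y₂) ^ 2 * (G (y₁ + y₂) * G (y₁ + (1 - y₂)) * G ((1 - y₁) + (1 - y₂)))
      + y₁ ^ 2 * y₂ ^ 2 * (G (y₁ + y₂) * G (y₁ + (1 - y₂)) * G ((1 - y₁) + y₂))) := by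
  obtain ⟨e1, e2, e3, e4⟩ := prod_erase_alias (fun m => G (uu y₁ y₂ m))
  unfold secularP
  rw [prod_alias, sum_alias, e1, e2, e3, e4]
  simp only [uu, ww]
  simp

/-- **THE SECULAR IDENTITY** (lens 1 gen 68 THEOREM (hh), `P − A·B·Q̃ == 0: True`):
`Π_n G(u_n) − Σ_n w_n·Π_{n′≠n} G(u_{n′}) = A·B·Q̃(A,B)` with `A = y₁(1 − y₁)`, `B = y₂(1 − y₂)`. [folklore] -/
theorem secular_identity (y₁ y₂ : ℝ) : secularP y₁ y₂ = (y₁ * (1 - y₁)) * (y₂ * (1 - y₂)) * Qt (y₁ * (1 - y₁)) (y₂ * (1 - y₂)) := by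
  rw [secularP_eq]; unfold G Qt; ring

/-! ### §5 The flat sharp secular inequality `S_φ ≤ 1` and its equality set -/

/-- lens 1's secular sum `S_φ(p) = Σ_n w_n ∕ G(u_n)` (`= Σ_n |t_n|² ∕ g(ω_n)`). [folklore] -/
def secularS (y₁ y₂ : ℝ) : ℝ := ∑ n, ww y₁ y₂ n / G (uu y₁ y₂ n)

/-- `0 < Π_n G(u_n)`. [folklore] -/
theorem prod_G_pos (y₁ y₂ : ℝ) : 0 < ∏ n, G (uu y₁ y₂ n) := prod_pos fun _ _ => G_pos _

/-- `w_n ∕ G(u_n) · Π_m G(u_m) = w_n · Π_{m≠n} G(u_m)`. [folklore] -/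
theorem div_mul_prod_eq (y₁ y₂ : ℝ) (n : Alias) :
    ww y₁ y₂ n / G (uu y₁ y₂ n) * ∏ m, G (uu y₁ y₂ m) = ww y₁ y₂ n * ∏ m ∈ univ.erase n, G (uu y₁ y₂ m) := by
  rw [← mul_prod_erase univ (fun m => G (uu y₁ y₂ m)) (mem_univ n)]
  field_simp [G_ne_zero (uu y₁ y₂ n)]

/-- `(1 − S_φ)·Π_n G(u_n) = P`. [folklore] -/
theorem one_sub_secularS_mul_prod (y₁ y₂ : ℝ) : (1 - secularS y₁ y₂) * ∏ n, G (uu y₁ y₂ n) = secularP y₁ y₂ := by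
  unfold secularS secularP
  rw [sub_mul, one_mul, sum_mul]
  congr 1
  exact sum_congr rfl fun n _ => div_mul_prod_eq y₁ y₂ n

/-- **the slack in closed form**: `1 − S_φ = A·B·Q̃(A,B) ∕ Π_n G(u_n)`. [folklore] -/
theorem one_sub_secularS_eq (y₁ y₂ : ℝ) :
    1 - secularS y₁ y₂ = (y₁ * (1 - y₁)) * (y₂ * (1 - y₂)) * Qt (y₁ * (1 - y₁)) (y₂ * (1 - y₂)) / ∏ n, G (uu y₁ y₂ n) := by
  rw [eq_div_iff (prod_G_pos y₁ y₂).ne', one_sub_secularS_mul_prod, secular_identity]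

/-- `A = y(1 − y) ∈ [0,¼]` for `y ∈ [0,1]`. [folklore] -/
theorem mul_one_sub_mem {y : ℝ} (h : y ∈ Set.Icc (0:ℝ) 1) : 0 ≤ y * (1 - y) ∧ y * (1 - y) ≤ 1 / 4 := by
  obtain ⟨h0, h1⟩ := h
  constructor
  · exact mul_nonneg h0 (by linarith)
  · nlinarith [sq_nonneg (y - 1 / 2)]

/-- `0 ≤ P` on `[0,1]²`. [folklore] -/
theorem secularP_nonneg {y₁ y₂ : ℝ} (h₁ : y₁ ∈ Set.Icc (0:ℝ) 1) (h₂ : y₂ ∈ Set.Icc (0:ℝ) 1) : 0 ≤ secularP y₁ y₂ := by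
  rw [secular_identity]
  obtain ⟨hA0, hA⟩ := mul_one_sub_mem h₁
  obtain ⟨hB0, hB⟩ := mul_one_sub_mem h₂
  exact mul_nonneg (mul_nonneg hA0 hB0) (Qt_nonneg hA0 hA hB0 hB)

/-- **THE FLAT SHARP SECULAR INEQUALITY** (lens 1 THEOREM (hh)): `S_φ(p) = Σ_n w_n ∕ G(u_n) ≤ 1` for all `(y₁,y₂) ∈ [0,1]²`. [folklore] -/
theorem secularS_le_one {y₁ y₂ : ℝ} (h₁ : y₁ ∈ Set.Icc (0:ℝ) 1) (h₂ : y₂ ∈ Set.Icc (0:ℝ) 1) : secularS y₁ y₂ ≤ 1 := by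
  have h := secularP_nonneg h₁ h₂
  rw [← one_sub_secularS_mul_prod] at h
  have := (mul_nonneg_iff_of_pos_right (prod_G_pos y₁ y₂)).mp h
  linarith

/-- `0 ≤ S_φ`. [folklore] -/
theorem secularS_nonneg (y₁ y₂ : ℝ) : 0 ≤ secularS y₁ y₂ :=
  sum_nonneg fun n _ => div_nonneg (ww_nonneg y₁ y₂ n) (G_pos _).le

/-- `y(1 − y) = 0 ↔ y = 0 ∨ y = 1`. [folklore] -/
theorem mul_one_sub_eq_zero_iff (y : ℝ) : y * (1 - y) = 0 ↔ y = 0 ∨ y = 1 := by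
  rw [mul_eq_zero, sub_eq_zero]; exact or_congr Iff.rfl eq_comm

/-- **THE EQUALITY SET** (lens 1: «equality iff A·B = 0, i.e. iff p lies on an axis»): on `[0,1]²`,
`S_φ = 1 ↔ (y₁ = 0 ∨ y₁ = 1) ∨ (y₂ = 0 ∨ y₂ = 1)`. [folklore] -/
theorem secularS_eq_one_iff {y₁ y₂ : ℝ} (h₁ : y₁ ∈ Set.Icc (0:ℝ) 1) (h₂ : y₂ ∈ Set.Icc (0:ℝ) 1) :
    secularS y₁ y₂ = 1 ↔ (y₁ = 0 ∨ y₁ = 1) ∨ (y₂ = 0 ∨ y₂ = 1) := by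
  rw [← mul_one_sub_eq_zero_iff, ← mul_one_sub_eq_zero_iff]
  have key : secularS y₁ y₂ = 1 ↔ (y₁ * (1 - y₁)) * (y₂ * (1 - y₂)) * Qt (y₁ * (1 - y₁)) (y₂ * (1 - y₂)) = 0 := by
    rw [← sub_eq_zero, ← neg_sub, neg_eq_zero, ← secular_identity, ← one_sub_secularS_mul_prod]
    rw [mul_eq_zero, or_iff_left (prod_G_pos y₁ y₂).ne']
  rw [key]
  obtain ⟨hA0, hA⟩ := mul_one_sub_mem h₁
  obtain ⟨hB0, hB⟩ := mul_one_sub_mem h₂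
  constructor
  · intro h
    rcases mul_eq_zero.mp h with h | h
    · exact mul_eq_zero.mp h
    · -- `Q̃ = 0` forces `A + B = 0`, hence `A·B = 0`
      by_cases hAB : y₁ * (1 - y₁) * (y₂ * (1 - y₂)) = 0
      · exact mul_eq_zero.mp hAB
      · exfalso
        have hA' : y₁ * (1 - y₁) ≠ 0 := fun h0 => hAB (by rw [h0, zero_mul])
        have hpos : 0 < y₁ * (1 - y₁) + y₂ * (1 - y₂) := by
          have := lt_of_le_of_ne hA0 (Ne.symm hA'); linarith
        exact (Qt_pos hA0 hA hB0 hB hpos).ne' h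
  · intro h
    rcases h with h | h <;> simp [h]

/-- off the axes the inequality is STRICT: `S_φ < 1` when `y₁, y₂ ∈ (0,1)`. [folklore] -/
theorem secularS_lt_one {y₁ y₂ : ℝ} (h₁ : y₁ ∈ Set.Ioo (0:ℝ) 1) (h₂ : y₂ ∈ Set.Ioo (0:ℝ) 1) : secularS y₁ y₂ < 1 := by
  have h₁' : y₁ ∈ Set.Icc (0:ℝ) 1 := ⟨h₁.1.le, h₁.2.le⟩
  have h₂' : y₂ ∈ Set.Icc (0:ℝ) 1 := ⟨h₂.1.le, h₂.2.le⟩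
  refine lt_of_le_of_ne (secularS_le_one h₁' h₂') fun h => ?_
  rcases (secularS_eq_one_iff h₁' h₂').mp h with (h | h) | (h | h)
  · exact h₁.1.ne' h
  · exact h₁.2.ne h
  · exact h₂.1.ne' h
  · exact h₂.2.ne h

/-- on the axis `y₂ = 0`: `S_φ(y₁, 0) = 1` for EVERY `y₁` (lens 1 gen 67's axis identity — the alias blocks where `EF^flat = φ(Hess^flat)`
exactly). [folklore] -/
theorem secularS_axis (y₁ : ℝ) : secularS y₁ 0 = 1 := by
  have h : (1 - secularS y₁ 0) * ∏ n, G (uu y₁ 0 n) = 0 := by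
    rw [one_sub_secularS_mul_prod, secular_identity]; ring
  rcases mul_eq_zero.mp h with h | h
  · linarith
  · exact absurd h (prod_G_pos y₁ 0).ne'

/-- and on the axis `y₁ = 0`. [folklore] -/
theorem secularS_axis' (y₂ : ℝ) : secularS 0 y₂ = 1 := by
  have h : (1 - secularS 0 y₂) * ∏ n, G (uu 0 y₂ n) = 0 := by
    rw [one_sub_secularS_mul_prod, secular_identity]; ring
  rcases mul_eq_zero.mp h with h | h
  · linarith
  · exact absurd h (prod_G_pos 0 y₂).ne'

/-- the diagonal value at the zone centre: `S_φ(½,½) = ¼` (all `u_n = 1`, all `w_n = 1∕16`). [folklore] -/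
theorem secularS_half_half : secularS (1 / 2) (1 / 2) = 1 / 4 := by
  unfold secularS; rw [sum_alias]; simp only [uu, ww, G]; norm_num

/-! ### §6 The trigonometric dictionary `y_μ = sin²(p_μ∕2)` -/

/-- `sin²(p∕2) ∈ [0,1]`. [folklore] -/
theorem sin_sq_half_mem (p : ℝ) : sin (p / 2) ^ 2 ∈ Set.Icc (0:ℝ) 1 :=
  ⟨sq_nonneg _, by rw [sq_le_one_iff_abs_le_one]; exact abs_sin_le_one _⟩

/-- `1 − sin²(p∕2) = cos²(p∕2)` (`x_μ = cos²(p_μ∕2)`). [folklore] -/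
theorem one_sub_sin_sq_half (p : ℝ) : 1 - sin (p / 2) ^ 2 = cos (p / 2) ^ 2 := by
  have := sin_sq_add_cos_sq (p / 2); linarith

/-- `A = x·y = sin²(p∕2)cos²(p∕2) = ¼ sin² p`. [folklore] -/
theorem sin_sq_half_mul (p : ℝ) : sin (p / 2) ^ 2 * (1 - sin (p / 2) ^ 2) = (1 / 4) * sin p ^ 2 := by
  rw [one_sub_sin_sq_half]
  have h : sin p = 2 * sin (p / 2) * cos (p / 2) := by rw [← sin_two_mul]; ring_nf
  rw [h]; ring

/-- `sin²(p∕2) ∈ {0,1} ↔ sin p = 0` (the axis alias blocks are `p ∈ πℤ`). [folklore] -/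
theorem sin_sq_half_corner_iff (p : ℝ) : (sin (p / 2) ^ 2 = 0 ∨ sin (p / 2) ^ 2 = 1) ↔ sin p = 0 := by
  rw [← mul_one_sub_eq_zero_iff, sin_sq_half_mul]
  constructor
  · intro h; have : sin p ^ 2 = 0 := by linarith
    exact pow_eq_zero_iff (n := 2) (by norm_num) |>.mp this
  · intro h; rw [h]; ring

/-- `4·sin²(q∕2)` at the alias-shifted momentum `q = p + π` is `4·cos²(p∕2) = 4(1 − y)`: the dictionary behind `u_n`. [folklore] -/
theorem sin_sq_half_add_pi (p : ℝ) : sin ((p + π) / 2) ^ 2 = 1 - sin (p / 2) ^ 2 := by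
  rw [one_sub_sin_sq_half, show (p + π) / 2 = p / 2 + π / 2 by ring, sin_add_pi_div_two]

/-- **THE FLAT SHARP SECULAR INEQUALITY IN MOMENTUM VARIABLES**: for every fine momentum `p = (p₁,p₂) ∈ ℝ²`,
`S_φ(p) = Σ_n w_n ∕ G(u_n) ≤ 1` at `y_μ = sin²(p_μ∕2)` — «all M at once (infinite volume included)» in lens 1's words. [folklore] -/
theorem secularS_le_one_trig (p₁ p₂ : ℝ) : secularS (sin (p₁ / 2) ^ 2) (sin (p₂ / 2) ^ 2) ≤ 1 :=
  secularS_le_one (sin_sq_half_mem p₁) (sin_sq_half_mem p₂)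

/-- **EQUALITY EXACTLY ON THE AXIS ALIAS BLOCKS**: `S_φ(p) = 1 ↔ sin p₁ = 0 ∨ sin p₂ = 0`. [folklore] -/
theorem secularS_eq_one_trig_iff (p₁ p₂ : ℝ) :
    secularS (sin (p₁ / 2) ^ 2) (sin (p₂ / 2) ^ 2) = 1 ↔ sin p₁ = 0 ∨ sin p₂ = 0 := by
  rw [secularS_eq_one_iff (sin_sq_half_mem p₁) (sin_sq_half_mem p₂), sin_sq_half_corner_iff, sin_sq_half_corner_iff]

end Summit.QuantumFields.BalabanUV.T4Continuum.NE7EJFlatSecular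

end
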